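import Literature.NumberTheory.NumberFields.RayClassFieldKernelIdele
import Literature.NumberTheory.GaloisRepresentations.LAdicCharacterGlobalValueProofs
import HarnessLib

/-!
# A Hecke character on `W_𝔪`, its idelic avatar on finite ideles, and THE VALUE OF ITS `p`-ADIC
# AVATAR ON `Gal(K̄/K(𝔪))` through the ray adic characters `κ_w`

De Shalit II.4.13 (p. 69) reads a Grössencharacter `ε` of conductor dividing `𝔣p^∞` as a `p`-adic
character `ε̂` of `𝒢 = Gal(K(𝔣p^∞)/K)`, and II.4.14 (36) (p. 71–73) evaluates `∫ ε̂ dμ` by writing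
`ε̂ = κ^k λ^{-j} χ` on `Gal(K̄/K(𝔣))` (`κ, λ` the `𝔭`- and `𝔭̄`-adic characters of I.3.3 (9) / II.1.7,
`χ` of finite order). In the tree: the avatar `r` of `φ` (`IsPAdicAvatarOf ι φ r`), its value
`avatarValueAt r σ ∈ ℂ_p`, the idelic avatar `lAdicAvatarHom φ ι pp qq` (Weil/Serre), the congruence
subgroup `W_𝔪 = rayUnitIdeles K 𝔪` and the ray adic characters `rayAdicCharacter h𝔪 hv hw`
(`RayClassFieldAdicCharacter.lean`). With `IsPAdicAvatarOf.avatarValueAt_eq` (global value through an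
idele, `LAdicCharacterGlobalValueProofs.lean`) and `exists_rayKernelIdele` (`σ|_{K^ab} = [e, K]`,
`e ∈ W_𝔪`, `e_∞ = 1`, `e_w = κ_w σ`; `RayClassFieldKernelIdele.lean`) this file computes:

* §1 `HeckeCharacter.eq_one_of_mem_rayUnitIdeles` — `φ(e) = 1` for `e ∈ W_𝔪`, `e_∞ = 1`, when a module
  of definition of `φ` divides `𝔪`; `HeckeCharacter.apply_eq_localUnits_rayComponent` — with ONE place
  `v` exempted: `φ(e) = φ_v(e_v)`.
* §2 `HeckeCharacter.coe_lAdicAvatarHom_of_fst_eq_one` — on a finite idele,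
  `ψ_p(x) = ι⁻¹(φ x) · Λ(x)`, `Λ = algPart` (`∏_{(w,e) : w ∣ p} e(x_w)^{−n}`); `PadicEmbedding.algPart_congr`
  — `Λ(x)` depends only on the components above `p`.
* §3 ★ `avatarValueAt_eq_of_mem_ker_rayClassField` — for `K` totally complex, `𝔪 ≠ 0` with
  `w_𝔪 = 1`, `σ ∈ Gal(K̄/K(𝔪))`, `φ` of type `(pp, qq)` with a module of definition dividing `𝔪` away
  from `v ∤ 𝔪`, and ANY avatar `r`:
  **`φ̂(σ) = ( ι⁻¹(φ_v(κ_v σ)) · Λ(e) )⁻¹`** with `e ∈ W_𝔪`, `e_∞ = 1`, `σ|_{K^ab} = [e, K]` and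
  `e_w = κ_w σ` at every `w ∤ 𝔪` — so `Λ(e) = ∏_{(w,ẽ) : w ∣ p} ẽ(κ_w σ)^{−n_{(w,ẽ)}}` whenever
  `(𝔪, p) = 1` (`algPart_congr`); at a split `p` in an imaginary quadratic field this is de Shalit's
  `κ(σ)^{∓m} λ(σ)^{±j}` bookkeeping.

Theorems only; no `sorry`.

## References
* [deShalit1987] E. de Shalit, *Iwasawa theory of elliptic curves with complex multiplication* (1987),
  II.4.13 (p. 69), II.4.14 (36) (p. 71–73), I.3.3 (9) (p. 18), II.1.7 (p. 41).
* [SerreAbelianLadic1968] J.-P. Serre, *Abelian ℓ-adic representations…* (1968), Ch. II §2.7.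
* [NeukirchANT1999] J. Neukirch, *Algebraic Number Theory* (1999), Ch. VII §6 (6.11)–(6.13),
  Ch. VI §7 (7.1).
-/

noncomputable section

open NumberField IsDedekindDomain IsDedekindDomain.HeightOneSpectrum Field
open scoped nonZeroDivisors Classical

namespace Literature.NumberTheory.NumberFields

open Literature.NumberTheory.GaloisRepresentations Literature.NumberTheory.EllipticCurves
open Literature.NumberTheory.GaloisRepresentations.HeckeCharacter
open Literature.NumberTheory.GaloisRepresentations.PadicEmbedding

variable {K : Type} [Field K] [NumberField K] {𝔪 : Ideal (𝓞 K)} {v : HeightOneSpectrum (𝓞 K)}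

/-! ### §1. A Hecke character on `W_𝔪` -/

/-- Every finite component of `e ∈ W_𝔪` is a local unit. [cite: NeukirchANT1999, Ch. VI §1 (1.7)] -/
theorem valued_snd_eq_one_of_mem_rayUnitIdeles {e : ideleGroup K} (he : e ∈ rayUnitIdeles K 𝔪)
    (w : HeightOneSpectrum (𝓞 K)) : Valued.v ((e : AdeleRing (𝓞 K) K).2 w) = 1 :=
  mem_unitIdeles_iff.mp (rayUnitIdeles_le_unitIdeles he) w

/-- `infPart e = 1` gives the archimedean component `e_∞ = 1`. [folklore] -/
private theorem fst_eq_one_of_infPart_eq_one {e : ideleGroup K} (h : infPart K e = 1) :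
    (e : AdeleRing (𝓞 K) K).1 = 1 := by
  rw [← val_infPart, h, Units.val_one]

/-- **`φ(e) = 1` for `e ∈ W_𝔪` with `e_∞ = 1` when a module of definition `(T, c)` of `φ` divides `𝔪`**
(`c_w ≤ ord_w 𝔪` on `T`): `e` lies in Neukirch's `I_f^𝔪`, killed by `φ` (`IsModulus`).
[cite: NeukirchANT1999, Ch. VII §6 (6.11)] -/
theorem HeckeCharacter.eq_one_of_mem_rayUnitIdeles {φ : HeckeCharacter K}
    {T : Finset (HeightOneSpectrum (𝓞 K))} {c : HeightOneSpectrum (𝓞 K) → ℕ} (hmod : IsModulus φ T c)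
    (hT : ∀ w ∈ T, (c w : ℤ) ≤ FractionalIdeal.count K w (𝔪 : FractionalIdeal (𝓞 K)⁰ K))
    {e : ideleGroup K} (he : e ∈ rayUnitIdeles K 𝔪) (hinf : infPart K e = 1) :
    φ e = 1 :=
  hmod e (fst_eq_one_of_infPart_eq_one hinf) (valued_snd_eq_one_of_mem_rayUnitIdeles he) fun w hw ↦
    ((mem_rayUnitIdeles_iff e).mp he w).2.trans (WithZero.exp_le_exp.mpr (neg_le_neg (hT w hw)))

/-- **One place exempted: `φ(e) = φ_v(e_v)`** for `e ∈ W_𝔪`, `e_∞ = 1`, `𝔪 ≠ 0`, when the module of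
definition `(T, c)` of `φ` divides `𝔪` AWAY FROM `v` (`c_w ≤ ord_w 𝔪` for `w ∈ T`, `w ≠ v`; no condition
at `v`): `e · ⟨e_v⟩_v⁻¹ ∈ W_{𝔪 v^{c_v}}` is killed by `φ`. [cite: NeukirchANT1999, Ch. VII §6 (6.11)]
[cite: deShalit1987, II.4.13 (p. 69)] -/
theorem HeckeCharacter.apply_eq_localUnits_rayComponent (h𝔪 : 𝔪 ≠ ⊥) {φ : HeckeCharacter K}
    {T : Finset (HeightOneSpectrum (𝓞 K))} {c : HeightOneSpectrum (𝓞 K) → ℕ} (hmod : IsModulus φ T c)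
    (hT : ∀ w ∈ T, w ≠ v → (c w : ℤ) ≤ FractionalIdeal.count K w (𝔪 : FractionalIdeal (𝓞 K)⁰ K))
    {e : ideleGroup K} (he : e ∈ rayUnitIdeles K 𝔪) (hinf : infPart K e = 1) :
    φ e = φ (localUnits v (Units.map ((v.adicCompletionIntegers K).subtype : _ →* _)
      (rayComponent v e he))) := by
  set u := localUnits v (Units.map ((v.adicCompletionIntegers K).subtype : _ →* _)
    (rayComponent v e he)) with hu_def
  have he' : e * u⁻¹ ∈ rayUnitIdeles K (𝔪 * v.asIdeal ^ (c v)) :=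
    mul_inv_localUnits_rayComponent_mem_rayUnitIdeles_mul_pow h𝔪 (c v) e he
  have hT' : ∀ w ∈ T, (c w : ℤ) ≤
      FractionalIdeal.count K w ((𝔪 * v.asIdeal ^ (c v) : Ideal (𝓞 K)) : FractionalIdeal (𝓞 K)⁰ K) := by
    intro w hw
    rw [count_mul_pow_eq h𝔪 (c v) w]
    by_cases hwv : w = v
    · subst hwv
      rw [if_pos rfl]
      have h0 := FractionalIdeal.count_coe_nonneg K w 𝔪
      omega
    · rw [if_neg hwv, add_zero]
      exact hT w hw hwv
  have hinf' : infPart K (e * u⁻¹) = 1 := by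
    rw [map_mul, map_inv, hinf, hu_def, infPart_localUnits, inv_one, mul_one]
  have h1 : φ (e * u⁻¹) = 1 := HeckeCharacter.eq_one_of_mem_rayUnitIdeles hmod hT' he' hinf'
  calc φ e = φ (e * u⁻¹ * u) := by rw [inv_mul_cancel_right]
    _ = φ u := by rw [map_mul, h1, one_mul]

/-! ### §2. The idelic avatar on finite ideles; `Λ` only sees the places above `p` -/

section Avatar

variable {p : ℕ} [Fact p.Prime]

/-- **On a finite idele (`x_∞ = 1`): `ψ_p(x) = ι⁻¹(φ(x)) · Λ(x)`** (the archimedean factor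
`A_{pp,qq}(x_∞)` is `1`). [cite: SerreAbelianLadic1968, Ch. II §2.7] -/
theorem HeckeCharacter.coe_lAdicAvatarHom_of_infPart_eq_one (φ : HeckeCharacter K)
    (ι : PadicAlgCl p ≃+* ℂ) (pp qq : InfinitePlace K → ℤ) {x : ideleGroup K} (hx : infPart K x = 1) :
    (lAdicAvatarHom φ ι pp qq x : PadicAlgCl p) = ι.symm (φ x : ℂ) * (algPart ι pp qq x : PadicAlgCl p) := by
  rw [coe_lAdicAvatarHom_apply, hx, map_one, inv_one, mul_one]

/-- **`Λ(x)` depends only on the components of `x` above `p`.** [cite: SerreAbelianLadic1968, Ch. II §2.7] -/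
theorem PadicEmbedding.algPart_congr (ι : PadicAlgCl p ≃+* ℂ) (pp qq : InfinitePlace K → ℤ)
    {x y : ideleGroup K}
    (h : ∀ w : HeightOneSpectrum (𝓞 K), ((p : ℕ) : 𝓞 K) ∈ w.asIdeal →
      (x : AdeleRing (𝓞 K) K).2 w = (y : AdeleRing (𝓞 K) K).2 w) :
    algPart ι pp qq x = algPart ι pp qq y := by
  rw [algPart_apply, algPart_apply]
  refine Finset.prod_congr rfl fun e _ ↦ ?_
  have he : e.eval x = e.eval y := Units.ext (by rw [PlaceEmb.coe_eval, PlaceEmb.coe_eval, h _ e.1.2])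
  rw [he]

/-- `Λ(x)` in coordinates: `(Λ(x) : ℚ̄_p) = ∏_{(w,ẽ)} ẽ(x_w)^{−n_{(w,ẽ)}}`. [cite: SerreAbelianLadic1968, Ch. II §2.7] -/
theorem PadicEmbedding.coe_algPart_apply (ι : PadicAlgCl p ≃+* ℂ) (pp qq : InfinitePlace K → ℤ)
    (x : ideleGroup K) :
    (algPart ι pp qq x : PadicAlgCl p) =
      ∏ e : PlaceEmb K p, e.2.1 ((x : AdeleRing (𝓞 K) K).2 e.1.1) ^ (-(e.exponent ι pp qq)) := by
  rw [algPart_apply, Units.coe_prod]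
  refine Finset.prod_congr rfl fun e _ ↦ ?_
  rw [Units.val_zpow_eq_zpow_val, PlaceEmb.coe_eval]

end Avatar

/-! ### §3. The avatar on `Gal(K̄/K(𝔪))` through the ray adic characters -/

section RayKernel

variable {p : ℕ} [Fact p.Prime] [IsTotallyComplex K]

/-- ★ **The `p`-adic avatar ON `Gal(K̄/K(𝔪))`** (`K` totally complex, `𝔪 ≠ 0`, `w_𝔪 = 1`, `v ∤ 𝔪`): for
`φ` of infinity type `(pp, qq)` with a module of definition `(T, c)` dividing `𝔪` away from `v`, ANY
avatar `r` of `φ` (`IsPAdicAvatarOf ι φ r`), and `σ ∈ Gal(K̄/K(𝔪))`, there is `e ∈ W_𝔪` with `e_∞ = 1`,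
`σ|_{K^ab} = [e, K]`, `e_w = κ_w σ` at every `w ∤ 𝔪`, and

  `φ̂(σ) = avatarValueAt r σ = ( ι⁻¹(φ(⟨κ_v σ⟩_v)) · Λ(e) )⁻¹`, `Λ(e) = ∏_{(w,ẽ) : w ∣ p} ẽ(e_w)^{−n_{(w,ẽ)}}`

— de Shalit's reading `ε̂ = χ_𝔭(κ) · κ^{∓k} λ^{±j}` of a Grössencharacter on `Gal(K̄/K(𝔣))` (II.4.13–4.14),
for a general totally complex `K`. [cite: deShalit1987, II.4.13 (p. 69), II.4.14 (36) (p. 71–73)]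
[cite: SerreAbelianLadic1968, Ch. II §2.7] -/
theorem avatarValueAt_eq_of_mem_ker_rayClassField (h𝔪 : 𝔪 ≠ ⊥) (hv : ¬ 𝔪 ≤ v.asIdeal)
    (hw : ∀ u : (𝓞 K)ˣ, (u : 𝓞 K) - 1 ∈ 𝔪 → u = 1) {φ : HeckeCharacter K} {pp qq : InfinitePlace K → ℤ}
    (hinf : φ.HasInfinityType pp qq) (ι : PadicAlgCl p ≃+* ℂ) {r : FramedGaloisRep K (PadicAlgCl p) 1}
    (hav : IsPAdicAvatarOf ι φ r) {T : Finset (HeightOneSpectrum (𝓞 K))}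
    {c : HeightOneSpectrum (𝓞 K) → ℕ} (hmod : IsModulus φ T c)
    (hT : ∀ w ∈ T, w ≠ v → (c w : ℤ) ≤ FractionalIdeal.count K w (𝔪 : FractionalIdeal (𝓞 K)⁰ K))
    (σ : ↥(absRestrictNormalHom (rayClassField K 𝔪)).ker) :
    ∃ e ∈ rayUnitIdeles K 𝔪, infPart K e = 1 ∧
      absGaloisAbProj K (σ : absoluteGaloisGroup K) = ideleArtinMap K e ∧
      (∀ (w : HeightOneSpectrum (𝓞 K)) (hvw : ¬ 𝔪 ≤ w.asIdeal),
        (e : AdeleRing (𝓞 K) K).2 w =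
          (((rayAdicCharacter h𝔪 hvw hw σ : (w.adicCompletionIntegers K)ˣ) :
            w.adicCompletionIntegers K) : w.adicCompletion K)) ∧
      avatarValueAt r σ =
        (((ι.symm (φ (localUnits v (Units.map ((v.adicCompletionIntegers K).subtype : _ →* _)
            (rayAdicCharacter h𝔪 hv hw σ))) : ℂ) * (algPart ι pp qq e : PadicAlgCl p))⁻¹ :
          PadicAlgCl p) : ℂ_[p]) := by
  obtain ⟨e, he, hinfe, hs, hcomp⟩ := exists_rayKernelIdele h𝔪 hw σ
  refine ⟨e, he, hinfe, hs, hcomp, ?_⟩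
  rw [hav.avatarValueAt_eq hinf ι hs, Units.val_inv_eq_inv_val,
    HeckeCharacter.coe_lAdicAvatarHom_of_infPart_eq_one φ ι pp qq hinfe,
    HeckeCharacter.apply_eq_localUnits_rayComponent (v := v) h𝔪 hmod hT he hinfe,
    ← rayAdicCharacter_eq_rayComponent h𝔪 hv hw σ he hs]

/-- **`Λ(e)` through the `κ_w`**: if moreover no place above `p` divides `𝔪`, then
`Λ(e) = Λ(y)` for ANY idele `y` with `y_w = κ_w σ` at the places `w ∣ p` — e.g. `y = ∏_{w∣p} ⟨κ_w σ⟩_w`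
(`coe_algPart_localUnits` evaluates such `Λ(y)` place by place). [cite: deShalit1987, II.4.13 (p. 69)] -/
theorem algPart_eq_of_forall_snd_eq_rayAdicCharacter (h𝔪 : 𝔪 ≠ ⊥)
    (hw : ∀ u : (𝓞 K)ˣ, (u : 𝓞 K) - 1 ∈ 𝔪 → u = 1)
    (hp : ∀ w : HeightOneSpectrum (𝓞 K), ((p : ℕ) : 𝓞 K) ∈ w.asIdeal → ¬ 𝔪 ≤ w.asIdeal)
    (ι : PadicAlgCl p ≃+* ℂ) (pp qq : InfinitePlace K → ℤ)
    (σ : ↥(absRestrictNormalHom (rayClassField K 𝔪)).ker) {e y : ideleGroup K}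
    (he : ∀ (w : HeightOneSpectrum (𝓞 K)) (hvw : ¬ 𝔪 ≤ w.asIdeal),
      (e : AdeleRing (𝓞 K) K).2 w =
        (((rayAdicCharacter h𝔪 hvw hw σ : (w.adicCompletionIntegers K)ˣ) :
          w.adicCompletionIntegers K) : w.adicCompletion K))
    (hy : ∀ (w : HeightOneSpectrum (𝓞 K)) (hpw : ((p : ℕ) : 𝓞 K) ∈ w.asIdeal),
      (y : AdeleRing (𝓞 K) K).2 w =
        (((rayAdicCharacter h𝔪 (hp w hpw) hw σ : (w.adicCompletionIntegers K)ˣ) :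
          w.adicCompletionIntegers K) : w.adicCompletion K)) :
    algPart ι pp qq e = algPart ι pp qq y :=
  PadicEmbedding.algPart_congr ι pp qq fun w hpw ↦ by rw [he w (hp w hpw), hy w hpw]

end RayKernel

end Literature.NumberTheory.NumberFields

end
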